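import Summits.QuantumFields.BalabanUV.T4Continuum.Support.NE9Lemma1Gain
import Summits.QuantumFields.BalabanUV.T4Continuum.Support.NE9LastCouplingBridge

/-!
# NE9PieceCouplingModulus — leaf A3 (`hTcup`, the CHANNEL COUPLING MODULUS) ON THE PIECE FORM of [II] (1.23)∕(1.33) with a
k-UNIFORM constant: ONE displayed per-piece COUPLING-RESPONSE bound of the (1.24)×(1.25) shape + the level counts of [II] p. 8
(`NE9Lemma1Gain.LevelCountsG` BY NAME) + the α-profile, SUMMED over the creation steps — and END-B with its whole CHANNEL SIDE
in [II] Lemma 1's per-piece ∕ counting vocabulary (cell `pub-balaban`, T4-DAG §2 node U3 ∕ §6 NE9; NE9 formalisation swarm,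
unit `b2b-balaban-t4-ne9-formalise-leaf-03` gen 3; the owner's pointer CLAIMS.log l.7710 «sum your per-piece COUPLING-Lipschitz
masses with `levels_boundG` BY NAME»; the repair the located finding F-ne9leaf03g3-1 (GAPS.md) calls for)

HONEST FRAMING (T4-DAG PAGE 1).  Rung (B)+1 on a FIXED finite torus — NOT infinite volume, NOT a mass gap, NOT the Clay
problem.  NE9 (`T4OutputRate.NE9` ∧ `FadingMemory`) is a cell NEW ESTIMATE, NOT PRINTED, and is NOT discharged here.
Everything below is bookkeeping over the ABSTRACT carriers of `T4OutputRate` and the row owner's abstract PIECE FORM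
`NE9Lemma1Counting.PieceData` ∕ `pieceChannel` (t4-ne9-p1 g23); every analytic input is a DISPLAYED binder stated INLINE — in
particular A3's per-piece coupling-response bound is NOT minted as a definition (trigger c3; referee DV-9).  [I] =
[Balaban1987RG1], [II] = [Balaban1988RG2Cluster] are quoted for TYPES only (ABSOLUTE RULE).  `FlowStep.BetaPertH`, (B), (B^μ) do
not occur.

WHERE THIS SITS.  The END faces display `hTcup : ∀ g g′ ∈ W, ∀ k y, |T k g (E g) y − T k g′ (E g) y| ≤ wt k y·(qT k·|g k − g′ k|)`
(leaf A3) next to the per-creation-step size binder S5 with weight `wt`.  The owner typed the channel of [II] (1.33) as the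
PIECE FORM `pieceChannel P k s H y = Σ_{j≤k} Σ_{□₀} Σ_{Y₀} Σ_{X ∈ src} piece(k,s,y,□₀,Y₀,X)(U ↦ H U X)` (*"It is a sum over all
admissible □₀, Y₀, j and X"*, p. 7) and proved S5 for it with `wt = weightOf P κ₁ d₀ O1 Kp`, `τ k j = c_Q·ω^{k−j}` from ONE
displayed per-piece SIZE bound `PieceBoundG` + the level counts `LevelCountsG` (`NE9Lemma1Gain.channelSizeAtStepNN_pieceG`).
The coupling history `s` enters the PIECES (through the shift 𝐇_k(s) — [I] (2.12) p. 268, [II] (1.21)–(1.23) p. 7).  The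
sibling `NE9EvalChannelCouplingModulus` §2 route to A3 (uniform `LipBackground` constant × kernel shift mass) is kernel-true
but NOT k-uniformly instantiable on this kernel (F-ne9leaf03g3-1: the step-j source-cube count (6L)⁴(L^jη)^{−4} of p. 8 is
beaten only by the gain of the per-piece bound).  THIS LEAF: from ONE displayed per-piece COUPLING-RESPONSE bound of the SAME
(1.24)×(1.25) shape per unit of the size constant — `|piece(k,g,…)(f) − piece(k,g′,…)(f)| ≤ Kp k y·qc·gain k j·e^{−κd(X)}·
exp(−⅛(κ₁−1)d_k(Y) + ⅛κ₁d₀ − ½(κ₁−1)·vol)·|g k − g′ k|` for `f = U ↦ H g U X` (TYPE: (1.24) read for the s-DERIVATIVE of the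
piece — the piece is linear in the shift whose size is «g_k|B|» ((1.21)∕(1.22) p. 7; p. 8 «Another possibility is to use the
expression g_k|B| instead of ε₁»); PROOF-INTERIOR (I.3.54) applied to the derivative; asserted nowhere) — and the owner's
`LevelCountsG` with the α-profile `ℓ = agePow ω`, the j-block differences are bounded by `levels_boundG` and SUMMED over
`j ≤ k` by `sum_tauOfG_le` (the (0.30) shape `Σ_j c_Q ω^{k−j} ≤ c_Q(1−ω)⁻¹`): **`qT k := qc·c_Q·(1 − ω)⁻¹`, uniform in k**, with
the SAME weight `weightOf P κ₁ d₀ O1 Kp` as S5.  §2 then applies END-B BY NAME at `T := pieceChannel P`, `Adm := univ` (the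
piece-form structure theorems hold on any class): the WHOLE channel side of END-B — S2∕S3∕S5∕A3 — is reduced to `SrcScale`,
`PieceBoundG`, the per-piece coupling response, `LevelCountsG` and scalars.  NOT PRINTED and not claimed: that Bałaban's
(1.23) pieces satisfy these bounds (instances O-NE9-2∕O-NE9-5, gated on the model O-NE9-1; the size bound is false for marginal
inputs — O-ne9p1g22-1 — so the instance lives on the projected∕marginal-free dictionary).  DISGUISE TEST: last coupling only,
SAME family, one output index; one history on the S5 side; not NE9.

WHAT IS PROVED (kernel, `[folklore]`; 0 sorry, 0 `def`).
§1 `stepBlock_sub_eq`, `abs_stepBlock_sub_le_of_response` (one creation step: `levels_boundG`), **`channelCouplingModulus_piece`**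
   (= the END's `hTcup` at `T := pieceChannel P`, `wt := weightOf …`, `qT k := qc·c_Q·(1−ω)⁻¹`).
§2 **`ne9_and_fadingMemory_of_couplingTwoPoint_pieceForm`** = END-B BY NAME, channel side in piece∕counting vocabulary;
   conclusion END-B's with `τbar := c_Q`, `qTbar := qc·c_Q·(1−ω)⁻¹`.

References (TYPES only): [Balaban1988RG2Cluster] CMP 116 (1988) (1.21)–(1.25) p. 7, (1.26)–(1.29) and l. 1–10 p. 8, (1.33)–(1.36)
p. 9; [Balaban1987RG1] CMP 109 (1987) (0.29)–(0.30) p. 258, (2.12)–(2.13) p. 268.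
-/

noncomputable section

namespace Summit.QuantumFields.BalabanUV.T4Continuum.NE9PieceCouplingModulus

open scoped BigOperators
open Literature.MathematicalPhysics.QuantumFieldTheory.Balaban1983to89
open Literature.MathematicalPhysics.QuantumFieldTheory.Balaban1983to89.T4OutputRate
open Literature.MathematicalPhysics.QuantumFieldTheory.Balaban1983to89.T4HistoryLipschitzRecursion
open Literature.MathematicalPhysics.QuantumFieldTheory.Balaban1983to89.T4HistoryLipschitzOuter
open Literature.MathematicalPhysics.QuantumFieldTheory.Balaban1983to89.T4HistoryLipschitzActivity
open Literature.MathematicalPhysics.QuantumFieldTheory.Balaban1983to89.T4HistoryLipschitzActivity (ClusterGeom)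
open Literature.MathematicalPhysics.QuantumFieldTheory.Balaban1983to89.T4HistoryLipschitzSegment
open Summit.QuantumFields.BalabanUV.T4Continuum.NE9Lemma1Counting
open Summit.QuantumFields.BalabanUV.T4Continuum.NE9Lemma1Gain
open Summit.QuantumFields.BalabanUV.T4Continuum.NE9LastCouplingBridge

variable {C : Carriers} {Bg ι α β γ : Type}

/-! ## §1 `hTcup` on the piece form with a k-uniform constant -/

/-- The difference of two one-creation-step blocks of the SAME input family at two histories is the nested sum of the
piece differences (each piece is additive; finite sums). [folklore] -/
theorem stepBlock_sub_eq (P : PieceData C Bg ι α β γ) (k : ℕ) (s s' : ℕ → ℝ) (H : Bg → C.Dom → ℝ) (y : ι) (j : ℕ) :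
    stepBlock P k s H y j - stepBlock P k s' H y j =
      ∑ a ∈ P.S0 k y, ∑ b ∈ P.SY k y a, ∑ x ∈ P.src k y a j,
        (P.piece k s y a b x (fun U => H U x) - P.piece k s' y a b x (fun U => H U x)) := by
  simp only [stepBlock, ← Finset.sum_sub_distrib]

/-- **ONE CREATION STEP (kernel)**: under the displayed per-piece COUPLING-RESPONSE bound of the (1.24)×(1.25) shape (constant
`Kp k y·qc·|s k − s′ k|`, general gain) and the level counts `LevelCountsG` with profile `ℓ`, the two histories' step-j blocks on
the same family differ by at most `Kp·qc·|Δs_k|·O1·(c_Q·ℓ k j)·e·exp(⅛κ₁d₀)·exp(−(1/16)κ₁d_k(Y))` — the owner's `levels_boundG`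
applied to the absolute piece differences. [cite: Balaban1988RG2Cluster, (1.24)-(1.28) pp.7-8] -/
theorem abs_stepBlock_sub_le_of_response (P : PieceData C Bg ι α β γ) {κ κ₁ d0 O1 cQ qc : ℝ} {Kp : ℕ → ι → ℝ}
    {gain ℓ : ℕ → ℕ → ℝ} {H : Bg → C.Dom → ℝ} {s s' : ℕ → ℝ} {k : ℕ} {y : ι} {j : ℕ}
    (hresp : ∀ a ∈ P.S0 k y, ∀ b ∈ P.SY k y a, ∀ x ∈ P.src k y a j,
      |P.piece k s y a b x (fun U => H U x) - P.piece k s' y a b x (fun U => H U x)| ≤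
        Kp k y * qc * gain k j * Real.exp (-(κ * C.d x)) *
          Real.exp (-(1 / 8) * (κ₁ - 1) * P.dY k y + (1 / 8) * κ₁ * d0 - (1 / 2) * (κ₁ - 1) * P.vol k y a b) *
            |s k - s' k|)
    (hL : LevelCountsG P κ κ₁ O1 cQ gain ℓ) (hKp : 0 ≤ Kp k y) (hqc : 0 ≤ qc) (hO1 : 0 ≤ O1)
    (hgain : ∀ k j, 0 ≤ gain k j) (hcQℓ : ∀ k j, 0 ≤ cQ * ℓ k j) :
    |stepBlock P k s H y j - stepBlock P k s' H y j| ≤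
      Kp k y * qc * |s k - s' k| * O1 * (cQ * ℓ k j) * Real.exp 1 * Real.exp ((1 / 8) * κ₁ * d0) *
        Real.exp (-(1 / 16) * κ₁ * P.dY k y) := by
  rw [stepBlock_sub_eq]
  have h1 : |∑ a ∈ P.S0 k y, ∑ b ∈ P.SY k y a, ∑ x ∈ P.src k y a j,
        (P.piece k s y a b x (fun U => H U x) - P.piece k s' y a b x (fun U => H U x))| ≤
      ∑ a ∈ P.S0 k y, ∑ b ∈ P.SY k y a, ∑ x ∈ P.src k y a j,
        |P.piece k s y a b x (fun U => H U x) - P.piece k s' y a b x (fun U => H U x)| := by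
    refine (Finset.abs_sum_le_sum_abs _ _).trans (Finset.sum_le_sum fun a _ => ?_)
    refine (Finset.abs_sum_le_sum_abs _ _).trans (Finset.sum_le_sum fun b _ => ?_)
    exact Finset.abs_sum_le_sum_abs _ _
  have hK : 0 ≤ Kp k y * qc * |s k - s' k| := mul_nonneg (mul_nonneg hKp hqc) (abs_nonneg _)
  have h2 := levels_boundG P hL hK hO1 hgain hcQℓ k y j
    (fun a b x => |P.piece k s y a b x (fun U => H U x) - P.piece k s' y a b x (fun U => H U x)|)
    (fun a _ b _ x _ => abs_nonneg _)
    (fun a ha b hb x hx => by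
      calc |P.piece k s y a b x (fun U => H U x) - P.piece k s' y a b x (fun U => H U x)|
          ≤ _ := hresp a ha b hb x hx
        _ = Kp k y * qc * |s k - s' k| * gain k j * Real.exp (-(κ * C.d x)) *
              Real.exp (-(1 / 8) * (κ₁ - 1) * P.dY k y + (1 / 8) * κ₁ * d0 - (1 / 2) * (κ₁ - 1) * P.vol k y a b) := by
            ring)
  exact h1.trans h2

/-- **LEAF A3 ON THE PIECE FORM WITH A k-UNIFORM CONSTANT (kernel; the theorem of this leaf).**  DISPLAYED (inline, asserted
nowhere for Bałaban's objects): for every pair of window histories, step `k`, output `y`, box □₀ = `a`, domain Y₀ = `b`, creation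
step `j` and source `x`, the piece at the two histories applied to the SAME function `U ↦ H g U x` differs by at most
`Kp k y·qc·gain k j·e^{−κd(x)}·exp(−⅛(κ₁−1)d_k(Y) + ⅛κ₁d₀ − ½(κ₁−1)·vol)·|g k − g′ k|` (TYPE = [II] (1.24)×(1.25) read for the
s-derivative of the piece through the shift 𝐇_k(s), per unit `qc` of the size constant `Kp`; PROOF-INTERIOR (I.3.54));
`LevelCountsG P κ κ₁ O1 c_Q gain (agePow ω)` BY NAME; scalars.  CONCLUSION: LITERALLY the END's `hTcup` clause at
`T := pieceChannel P` with the S5 weight `wt := weightOf P κ₁ d₀ O1 Kp` and the k-UNIFORM `qT k := qc·c_Q·(1 − ω)⁻¹` — the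
creation steps are summed by the geometric profile ([I] (0.30) p. 258 shape, `sum_tauOfG_le`).
[cite: Balaban1988RG2Cluster, (1.23)-(1.29) pp.7-8, (1.33)-(1.36) p.9; Balaban1987RG1, (0.30) p.258, (2.12)-(2.13) p.268] -/
theorem channelCouplingModulus_piece (P : PieceData C Bg ι α β γ) {W : Set (ℕ → ℝ)} {H : (ℕ → ℝ) → Bg → C.Dom → ℝ}
    {κ κ₁ d0 O1 cQ ω qc : ℝ} {Kp : ℕ → ι → ℝ} {gain : ℕ → ℕ → ℝ}
    (hresp : ∀ g ∈ W, ∀ g' ∈ W, ∀ (k : ℕ) (y : ι), ∀ a ∈ P.S0 k y, ∀ b ∈ P.SY k y a, ∀ (j : ℕ), ∀ x ∈ P.src k y a j,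
      |P.piece k g y a b x (fun U => H g U x) - P.piece k g' y a b x (fun U => H g U x)| ≤
        Kp k y * qc * gain k j * Real.exp (-(κ * C.d x)) *
          Real.exp (-(1 / 8) * (κ₁ - 1) * P.dY k y + (1 / 8) * κ₁ * d0 - (1 / 2) * (κ₁ - 1) * P.vol k y a b) *
            |g k - g' k|)
    (hL : LevelCountsG P κ κ₁ O1 cQ gain (agePow ω)) (hKp : ∀ k y, 0 ≤ Kp k y) (hqc : 0 ≤ qc) (hO1 : 0 ≤ O1)
    (hgain : ∀ k j, 0 ≤ gain k j) (hcQ : 0 ≤ cQ) (hω0 : 0 ≤ ω) (hω1 : ω < 1) :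
    ∀ g ∈ W, ∀ g' ∈ W, ∀ (k : ℕ) (y : ι),
      |pieceChannel P k g (H g) y - pieceChannel P k g' (H g) y| ≤
        weightOf P κ₁ d0 O1 Kp k y * (qc * cQ * (1 - ω)⁻¹ * |g k - g' k|) := by
  intro g hg g' hg' k y
  have hcQℓ : ∀ k j, 0 ≤ cQ * agePow ω k j := fun k j => mul_nonneg hcQ (agePow_nonneg hω0 k j)
  -- the constant in front of the per-step profile
  set A : ℝ := Kp k y * qc * |g k - g' k| * O1 * Real.exp 1 * Real.exp ((1 / 8) * κ₁ * d0) *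
    Real.exp (-(1 / 16) * κ₁ * P.dY k y) with hA
  have hA0 : 0 ≤ A := by
    rw [hA]
    have := hKp k y
    positivity
  have hstep : ∀ j ∈ Finset.range (k + 1),
      |stepBlock P k g (H g) y j - stepBlock P k g' (H g) y j| ≤ A * tauOfG cQ (agePow ω) k j := by
    intro j _
    have h := abs_stepBlock_sub_le_of_response P (s := g) (s' := g') (H := H g) (k := k) (y := y) (j := j)
      (fun a ha b hb x hx => hresp g hg g' hg' k y a ha b hb j x hx) hL (hKp k y) hqc hO1 hgain hcQℓ
    calc |stepBlock P k g (H g) y j - stepBlock P k g' (H g) y j| ≤ _ := h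
      _ = A * tauOfG cQ (agePow ω) k j := by rw [hA]; simp only [tauOfG]; ring
  rw [pieceChannel_eq_sum_stepBlock, pieceChannel_eq_sum_stepBlock, ← Finset.sum_sub_distrib]
  calc |∑ j ∈ Finset.range (k + 1), (stepBlock P k g (H g) y j - stepBlock P k g' (H g) y j)|
      ≤ ∑ j ∈ Finset.range (k + 1), |stepBlock P k g (H g) y j - stepBlock P k g' (H g) y j| :=
        Finset.abs_sum_le_sum_abs _ _
    _ ≤ ∑ j ∈ Finset.range (k + 1), A * tauOfG cQ (agePow ω) k j := Finset.sum_le_sum hstep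
    _ = A * ∑ j ∈ Finset.range (k + 1), tauOfG cQ (agePow ω) k j := by rw [Finset.mul_sum]
    _ ≤ A * (cQ * (1 - ω)⁻¹) := mul_le_mul_of_nonneg_left (sum_tauOfG_le hcQ hω0 hω1 k) hA0
    _ = weightOf P κ₁ d0 O1 Kp k y * (qc * cQ * (1 - ω)⁻¹ * |g k - g' k|) := by
        rw [hA]; simp only [weightOf]; ring

/-! ## §2 END-B on the piece form: the whole channel side in per-piece ∕ counting vocabulary -/

section EndFace

variable (G : ClusterGeom C) {Pot : Type*} [NormedAddCommGroup Pot] [NormedSpace ℂ Pot]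

/-- **NE9 ∧ FADING MEMORY, COUPLING TWO-POINT END ON THE PIECE FORM (kernel end-to-end).**  END-B
`NE9LastCouplingBridge.ne9_and_fadingMemory_of_couplingTwoPoint` APPLIED BY NAME at `T := pieceChannel P`, `Adm := Set.univ`,
`wt := weightOf P κ₁ d₀ O1 Kp`, `τ := tauOfG c_Q (agePow ω)`: the channel STRUCTURE binders `AdmissibleTerms`∕`AdmRestrict`
(trivial on `univ`), `ChannelAdditive` (`channelAdditive_piece`), `ChannelStepSum` (`channelStepSum_piece`, from the source
discipline `SrcScale`), the SIZE binder S5 `ChannelSizeAtStepNN` (the owner's `channelSizeAtStepNN_pieceG` from the displayed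
`PieceBoundG` + `LevelCountsG`) with its profile (`profileG`), and A3 `hTcup` (§1 from the displayed per-piece coupling response)
are ALL supplied; every non-channel binder of END-B (activities' `TwoPointKP` ∕ `hCup`, `hrepr`, `hexpl`, geometry, reading,
occupation, scalars) VERBATIM.  Displayed after this face on the channel side: `SrcScale P`, `PieceBoundG P κ κ₁ d₀ Kp gain` (S5's
per-piece size bound — CAVEAT O-ne9p1g22-1: for marginal-free ∕ projected inputs), the per-piece coupling response (A3's),
`LevelCountsG P κ κ₁ O1 c_Q gain (agePow ω)`, `0 ≤ ω < 1`, `qc`, `c_Q`, `O1`, `Kp ≥ 0`.  Conclusion = END-B's with `τbar := c_Q`,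
`qTbar := qc·c_Q·(1−ω)⁻¹`.  Nothing of [I]–[II] asserted; NE9 NOT PROVED; 0∕9 unchanged.
[cite: Balaban1988RG2Cluster, (1.23)-(1.29) pp.7-8, (1.33)-(1.36) p.9, Lemma 3 (2.38) p.20; Balaban1987RG1, (0.30) p.258, (2.12)-(2.13) p.268] -/
theorem ne9_and_fadingMemory_of_couplingTwoPoint_pieceForm (P : PieceData C Bg ι α β γ) {E : Functional C Bg}
    {W : Set (ℕ → ℝ)} {Ψ : ℕ → ℝ → (ι → ℝ) → Bg → C.Dom → ℝ} {act : ℕ → ℝ → Bg → Pot → G.P → ℂ} {𝒜 : ℕ → Set Pot}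
    {n : ℕ → ℝ → Bg → G.P → ℝ} {lip clip : ℕ → ℝ} {a d : G.P → ℝ} {δ : C.Dom → ℝ}
    {κ κ₁ d0 O1 cQ ω qc B lipbar clipbar pexbar : ℝ} {Kp : ℕ → ι → ℝ} {gain : ℕ → ℕ → ℝ} {pex : ℕ → ℝ}
    (ρ : ℕ → (ι → ℝ) → Pot) (expl : ℕ → ℝ → Bg → C.Dom → ℝ) (h0 : ScaleZeroFree E W)
    -- the channel side in piece / counting vocabulary
    (hsrc : SrcScale P) (hPiece : PieceBoundG P κ κ₁ d0 Kp gain) (hL : LevelCountsG P κ κ₁ O1 cQ gain (agePow ω))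
    (hresp : ∀ g ∈ W, ∀ g' ∈ W, ∀ (k : ℕ) (y : ι), ∀ a' ∈ P.S0 k y, ∀ b ∈ P.SY k y a', ∀ (j : ℕ), ∀ x ∈ P.src k y a' j,
      |P.piece k g y a' b x (fun U => E g U x) - P.piece k g' y a' b x (fun U => E g U x)| ≤
        Kp k y * qc * gain k j * Real.exp (-(κ * C.d x)) *
          Real.exp (-(1 / 8) * (κ₁ - 1) * P.dY k y + (1 / 8) * κ₁ * d0 - (1 / 2) * (κ₁ - 1) * P.vol k y a' b) *
            |g k - g' k|)
    (hKp : ∀ k y, 0 ≤ Kp k y) (hqc : 0 ≤ qc) (hO1 : 0 ≤ O1) (hgain : ∀ k j, 0 ≤ gain k j) (hcQ : 0 ≤ cQ)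
    (hω0 : 0 ≤ ω) (hω1 : ω < 1)
    (hfac : Factorises E W (pieceChannel P) Ψ)
    -- the activities' coupling two-point clause (END-B, verbatim)
    (hclip0 : ∀ k, 0 ≤ clip k)
    (hCup : ∀ g ∈ W, ∀ g' ∈ W, ∀ (k : ℕ) (U : Bg) (X : C.Dom), C.scale X = k + 1 → ∀ Q ∈ 𝒜 k, ∀ γ' ∈ G.vol X,
      ‖act k (g k) U Q γ'‖ ≤ n k (g' k) U γ' ∧
        ‖act k (g k) U Q γ' - act k (g' k) U Q γ'‖ ≤ clip k * |g k - g' k| * n k (g' k) U γ')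
    -- representation and explicit part (END-B, verbatim)
    (hrepr : ∀ (k : ℕ) (s : ℝ) (Q : ι → ℝ) (U : Bg) (X : C.Dom),
      Ψ k s Q U X = (G.newTerm act k s U X (ρ k Q)).re + expl k s U X)
    (hexpl : ∀ g ∈ W, ∀ g' ∈ W, ∀ (k : ℕ) (U : Bg) (X : C.Dom), C.scale X = k + 1 →
      |expl k (g k) U X - expl k (g' k) U X| ≤ Real.exp (-(κ * C.d X)) * (pex k * |g k - g' k|))
    (hclipb : ∀ k, clip k ≤ clipbar) (hpexb : ∀ k, pex k ≤ pexbar) (hpexbar : 0 ≤ pexbar)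
    -- the table channel and the common data (P2, verbatim)
    (hK : TwoPointKP G W act 𝒜 n lip a d) (hdec : G.DecayExtract δ d) (hpin : G.PinBudget a δ (fun _ => B) κ)
    (hρ : ∀ (k : ℕ) (Q Q' : ι → ℝ) (M : ℝ), (∀ y, |Q y - Q' y| ≤ weightOf P κ₁ d0 O1 Kp k y * M) → ‖ρ k Q - ρ k Q'‖ ≤ M)
    (hocc : ∀ g ∈ W, ∀ g' ∈ W, ∀ k : ℕ, ρ k (pieceChannel P k g' (E g)) ∈ 𝒜 k)
    (hB : 0 ≤ B) (hlipb : ∀ k, lip k ≤ lipbar) (hpos : 0 < ω + 4 * lipbar * B * cQ) :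
    NE9 E W κ (prodModuli (4 * clipbar * B + pexbar + 4 * lipbar * B * (qc * cQ * (1 - ω)⁻¹))
        fun _ => ω + 4 * lipbar * B * cQ) ∧
      FadingMemory ((4 * clipbar * B + pexbar + 4 * lipbar * B * (qc * cQ * (1 - ω)⁻¹)) / (ω + 4 * lipbar * B * cQ))
        (ω + 4 * lipbar * B * cQ)
        (prodModuli (4 * clipbar * B + pexbar + 4 * lipbar * B * (qc * cQ * (1 - ω)⁻¹))
          fun _ => ω + 4 * lipbar * B * cQ) := by
  have hcQℓ : ∀ k j, 0 ≤ cQ * agePow ω k j := fun k j => mul_nonneg hcQ (agePow_nonneg hω0 k j)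
  have hqT0 : 0 ≤ qc * cQ * (1 - ω)⁻¹ := by
    have : 0 < 1 - ω := by linarith
    positivity
  have hAdm : AdmissibleTerms E W (Set.univ : Set (Bg → C.Dom → ℝ)) :=
    ⟨fun _ _ => Set.mem_univ _, fun _ _ _ _ => Set.mem_univ _⟩
  have hres : AdmRestrict (C := C) (Set.univ : Set (Bg → C.Dom → ℝ)) :=
    ⟨fun _ _ _ => Set.mem_univ _, fun _ _ _ => Set.mem_univ _⟩
  have hτ : ∀ k j, j ≤ k → 0 ≤ tauOfG cQ (agePow ω) k j ∧ tauOfG cQ (agePow ω) k j ≤ cQ * ω ^ (k - j) :=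
    fun k j hjk => ⟨hcQℓ k j, (profileG hcQ hω0).1 k j hjk⟩
  exact ne9_and_fadingMemory_of_couplingTwoPoint G (qT := fun _ => qc * cQ * (1 - ω)⁻¹) ρ expl h0 hAdm hres
    (channelAdditive_piece P Set.univ) (channelStepSum_piece hsrc Set.univ)
    (channelSizeAtStepNN_pieceG hsrc hPiece hL hKp hO1 hgain hcQℓ Set.univ) hfac hclip0 hCup (fun _ => hqT0)
    (channelCouplingModulus_piece P (H := E) hresp hL hKp hqc hO1 hgain hcQ hω0 hω1) hrepr hexpl hclipb hpexb hpexbar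
    (fun _ => le_rfl) hK hdec hpin hρ hocc hB hlipb hcQ hω0 hpos hτ

end EndFace

end Summit.QuantumFields.BalabanUV.T4Continuum.NE9PieceCouplingModulus

end
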